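import Literature.ModelTheory.ExponentialFields.MacintyreWilkie
import HarnessLib

/-!
# Macintyre–Wilkie's recursive subtheory: the model-theoretic form of the unconditional half

Family `periods` (periods.S27), topic `Literature/ModelTheory/ExponentialFields`, companion to
`MacintyreWilkie.lean`.  The named fact
`Literature.ModelTheory.ExponentialFields.macintyreWilkie_recursiveSubtheory` (A0) — there is a
*recursive* `T₀ ⊆ Th(ℝ_exp)` with `T₀ ∪ Th_∃(ℝ_exp) ⊨ Th(ℝ_exp)` — is Macintyre–Wilkie's
*effective model completeness* of the real exponential field (Macintyre–Wilkie 1996, §§2–3: an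
explicit recursively axiomatized subtheory of `T_exp`, Wilkie's model completeness theorem for the
restricted exponential made effective through Khovanskii's bounds, and the passage from the
restricted to the unrestricted exponential; Jones–Servi 2011, §2 and Prop. 3.1, run the same
argument for `x^α`).  It is a theory-sized result resting on o-minimality, Khovanskii's finiteness
theorem and Wilkie's theorems, none of which is available in Mathlib or proved in this tree, and
it is **not** discharged here.  Since the conditional half of Macintyre–Wilkie's theorem is now
proved (`macintyreWilkie_existential_of_schanuelProperty_holds`, `MacintyreWilkieProofs.lean`),
(A0) is exactly what remains of `Literature.ModelTheory.ExponentialFields.macintyre_wilkie`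
(`macintyre_wilkie_of_recursiveSubtheory` of `MacintyreWilkie.lean` applied to that discharge);
indeed, given the conditional half, under the real Schanuel property (A0) is *equivalent* to the
decidability of `Th(ℝ_exp)` (for the converse take `T₀ = Th(ℝ_exp)` itself,
`realExpDecidable_iff_isRecursive`), so no shortcut to it is to be expected.  This file does not
import `MacintyreWilkieProofs.lean` (to keep the generic model theory below free of the analytic
imports); composing `macintyreWilkie_recursiveSubtheory_of_forall_embedding` (here) with
`macintyre_wilkie_of_recursiveSubtheory` and the discharged conditional half gives
`macintyre_wilkie` from a recursive set of true sentences all of whose models containing `ℝ_exp`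
are models of `Th(ℝ_exp)`.

What this file proves is the purely model-theoretic content of the shape of (A0): the syntactic
condition "`T₀ ∪ Th_∃(M) ⊨ Th(M)`" on a theory `T₀` is *equivalent* to the semantic condition

> every model of `T₀` into which `M` embeds is elementarily equivalent to `M`

(`FirstOrder.Language.Theory.models_union_existentialTheory_iff_forall_embedding`), so that (A0)
reads: **`Th(ℝ_exp)` is axiomatized, over the structures containing `ℝ_exp`, by a recursive set of
true sentences** (`Literature.ModelTheory.ExponentialFields.macintyreWilkie_recursiveSubtheory_iff_forall_embedding`).
This is the form in which a candidate `T₀` (Macintyre–Wilkie's `T`, or any other) has to be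
verified: no existential theory and no Gödel numbering of consequences is involved on the
right-hand side beyond the recursiveness of `T₀` itself, and a recursive *model complete*
`T₀ ⊆ Th(ℝ_exp)` (the witness Macintyre–Wilkie construct) satisfies it because then `ℝ_exp ≼ N`
for every `T₀`-model `N ⊇ ℝ_exp` (`model_realExpTheory_of_isModelComplete` below; compare
`macintyreWilkie_recursiveSubtheory_of_isModelComplete` in `MacintyreWilkie.lean`).

The one non-formal ingredient is **existential amalgamation over the existential theory**
(Tent–Ziegler 2012, Lemma 3.1.2 and the remark following it, with `Δ` = existential formulas:
"`𝔄 ⇒_Δ 𝔅` if and only if there exists a map `f` and a structure `𝔅' ≡ 𝔅` such that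
`f : 𝔄 →_Δ 𝔅'`"): if every existential sentence true in `M` is true in `N`, then `M` embeds into
an elementary extension of `N`
(`FirstOrder.Language.Theory.Model.exists_elementaryEmbedding_embedding`), proved by compactness
from the elementary diagram of `N` and the quantifier-free diagram of `M`, the finite parts of the
latter being realized in `N` through the existential closures of quantifier-free formulas
(`FirstOrder.Language.Theory.Model.exists_realize_of_isQF`); the diagram and compactness tools are
those of `UniversalTheories/HerbrandSaturation.lean` and `ModelCompleteness/RobinsonTest.lean`.

## Main statements

* `FirstOrder.Language.BoundedFormula.IsQF.isExistential_exClosure`: the existential closure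
  (Mathlib's `Formula.exClosure`) of a quantifier-free formula is an existential sentence.
* `FirstOrder.Language.Theory.Model.exists_realize_of_isQF`: if `N ⊨ Th_∃(M)`, every
  quantifier-free formula with parameters from `M` true in `M` is realized in `N`.
* `FirstOrder.Language.Theory.Model.exists_elementaryEmbedding_embedding` (existential
  amalgamation): if `N ⊨ Th_∃(M)` then there are `K`, `N ↪ₑ[L] K` and `M ↪[L] K`.
* `FirstOrder.Language.Theory.models_union_existentialTheory_iff_forall_embedding`:
  `(∀ φ, M ⊨ φ → T₀ ∪ Th_∃(M) ⊨ φ) ↔ (∀ N ⊨ T₀, (M ↪[L] N) → ∀ φ, M ⊨ φ → N ⊨ φ)`.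
* `Literature.ModelTheory.ExponentialFields.realExpTheory_models_union_existential_iff_forall_embedding`,
  `Literature.ModelTheory.ExponentialFields.macintyreWilkie_recursiveSubtheory_iff_forall_embedding`,
  `Literature.ModelTheory.ExponentialFields.macintyreWilkie_recursiveSubtheory_of_forall_embedding`:
  the specialisation to `ℝ_exp` and the resulting form of (A0);
  `Literature.ModelTheory.ExponentialFields.model_realExpTheory_of_isModelComplete`: a model
  complete true `T₀` satisfies the criterion (the case of Macintyre–Wilkie's witness; with
  `macintyreWilkie_recursiveSubtheory_of_forall_embedding` this re-proves
  `macintyreWilkie_recursiveSubtheory_of_isModelComplete` of `MacintyreWilkie.lean`);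
  `Literature.ModelTheory.ExponentialFields.model_union_realExpExistentialTheory_iff`: for a
  witness `T₀` of (A0), the models of `T₀ ∪ Th_∃(ℝ_exp)` are exactly the models of `Th(ℝ_exp)`.

## Design

As in `MacintyreWilkie.lean`, the generic material is placed as deliberate dot-notation
extensions in Mathlib's namespaces `FirstOrder.Language.BoundedFormula`,
`FirstOrder.Language.Theory.Model` and `FirstOrder.Language.Theory`; everything about `ℝ_exp`
lives in `namespace Literature.ModelTheory.ExponentialFields`.  Models range over arbitrary
universes where compactness permits: the amalgam `K` lives in `Type (max u v w w')` (the universe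
of Mathlib's models of `L[[M ⊕ N]]`-theories), so the semantic side of the criterion quantifies
over `N : Type (max u v w)`; for `Language.orderedExpRing` and `ℝ` this is `Type`.

## References

* A. Macintyre, A. J. Wilkie, *On the decidability of the real exponential field*, in:
  Kreiseliana: About and Around Georg Kreisel, A K Peters (1996), 441–467, §§2–3 (p. 448).
* G. O. Jones, T. Servi, *On the decidability of the real field with a generic power function*,
  J. Symb. Log. 76 (2011), §2 (Thm. 2.5), §3 (Prop. 3.1).
* K. Tent, M. Ziegler, *A Course in Model Theory*, Lecture Notes in Logic 40, CUP (2012),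
  Lemma 3.1.2 and the remark following it.
-/

universe u v w w'

open FirstOrder FirstOrder.Language FirstOrder.Language.BoundedFormula Set

namespace FirstOrder.Language

variable {L : Language.{u, v}}

/-! ### Existential closures of quantifier-free formulas -/

/-- The existential closure `∃ x̄ φ(x̄)` (Mathlib's `Formula.exClosure`, quantifying the finitely
many free variables that occur) of a quantifier-free formula is an existential sentence.
[folklore] -/
theorem BoundedFormula.IsQF.isExistential_exClosure {α : Type w} [DecidableEq α]
    {φ : L.Formula α} (h : φ.IsQF) : BoundedFormula.IsExistential φ.exClosure := by
  unfold Formula.exClosure Formula.iExs Formula.relabel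
  exact (((h.restrictFreeVar _).relabel _).relabel _).isExistential.exs

namespace Theory

/-! ### Existential amalgamation over the existential theory -/

section Amalgamation

variable {M : Type w} [L.Structure M] {N : Type w'} [L.Structure N]

/-- If every existential sentence true in `M` is true in `N` (`N ⊨ Th_∃(M)`), then every
quantifier-free formula with parameters from `M` (represented as variables indexed by `M`) that
is true in `M` is realized in `N` by some assignment of the parameters: its existential closure
is an existential sentence true in `M` (Tent–Ziegler 2012, proof of Lemma 3.1.2: "`𝔄` is a model
of `φ = ∃x̄ δ(x̄)`, so by assumption …"). [cite: TentZiegler2012, Lemma 3.1.2] -/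
theorem Model.exists_realize_of_isQF [Nonempty N] (hN : N ⊨ L.existentialTheory M)
    {ψ : L.Formula M} (hψ : ψ.IsQF) (hM : ψ.Realize (id : M → M)) :
    ∃ w : M → N, ψ.Realize w := by
  classical
  obtain ⟨n₀⟩ := ‹Nonempty N›
  have hMσ : M ⊨ ψ.exClosure := by
    rw [Formula.realize_exClosure]
    exact ⟨fun a => (a : M),
      (BoundedFormula.realize_restrictFreeVar (f := id) (v := fun a : ψ.freeVarFinset => (a : M))
        (id : M → M) (fun _ => rfl)).2 hM⟩
  have hNσ : N ⊨ ψ.exClosure := hN.realize_of_mem _ ⟨hψ.isExistential_exClosure, hMσ⟩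
  rw [Formula.realize_exClosure] at hNσ
  obtain ⟨i, hi⟩ := hNσ
  let w : M → N := fun m => if hm : m ∈ ψ.freeVarFinset then i ⟨m, hm⟩ else n₀
  have hw : ∀ a : ψ.freeVarFinset, i (id a) = w a := fun a => by
    simp only [w, id_eq, dif_pos a.2, Subtype.coe_eta]
  exact ⟨w, (BoundedFormula.realize_restrictFreeVar w hw).1 hi⟩

open Literature.ModelTheory.UniversalTheories Literature.ModelTheory.ModelCompleteness in
/-- **Existential amalgamation over the existential theory** (Tent–Ziegler 2012, Lemma 3.1.2
with `T = Th(𝔅_B)` and `Δ` the existential formulas, i.e. the remark following it: "`𝔄 ⇒_Δ 𝔅`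
if and only if there exists a map `f` and a structure `𝔅' ≡ 𝔅` such that `f : 𝔄 →_Δ 𝔅'`").
If every existential sentence true in `M` is true in `N`, then `M` embeds into an elementary
extension of `N`: there are a structure `K`, an elementary embedding `N ↪ₑ[L] K` and an
embedding `M ↪[L] K`.  Proof: compactness for (elementary diagram of `N`) ∪ (quantifier-free
diagram of `M`), as sentences about constants `M ⊕ N`; a finite part is realized in `N` itself,
the `M`-part by `Model.exists_realize_of_isQF`.  The structure `K` lives in the universe
`max u v w w'` of Mathlib's models of `L[[M ⊕ N]]`-theories. [cite: TentZiegler2012, Lemma 3.1.2] -/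
theorem Model.exists_elementaryEmbedding_embedding [Nonempty M] [Nonempty N]
    (hN : N ⊨ L.existentialTheory M) :
    ∃ (K : Type (max u v w w')) (_ : L.Structure K) (_ : N ↪ₑ[L] K), Nonempty (M ↪[L] K) := by
  classical
  let S₁ : Set (L.Formula (M ⊕ N)) :=
    (fun φ : L.Formula N => φ.relabel Sum.inr) '' {φ | φ.Realize (id : N → N)}
  let S₂ : Set (L.Formula (M ⊕ N)) :=
    (fun ψ : L.Formula M => ψ.relabel Sum.inl) '' {ψ | ψ.IsQF ∧ ψ.Realize (id : M → M)}
  -- finite parts of `S₁ ∪ S₂` are realized in `N`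
  have hfin : ∀ F : Set (L.Formula (M ⊕ N)), F ⊆ S₁ ∪ S₂ → F.Finite →
      ∃ v₀ : M ⊕ N → N, ∀ φ ∈ F, φ.Realize v₀ := by
    intro F hF hFfin
    haveI : Finite ↥(F ∩ S₂) := (hFfin.subset Set.inter_subset_left).to_subtype
    have hpre : ∀ χ : ↥(F ∩ S₂), ∃ ψ : L.Formula M,
        (ψ.IsQF ∧ ψ.Realize (id : M → M)) ∧ ψ.relabel Sum.inl = (χ : L.Formula (M ⊕ N)) :=
      fun χ => by
        obtain ⟨ψ, hψ, h⟩ := χ.2.2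
        exact ⟨ψ, hψ, h⟩
    choose pre hpre₁ hpre₂ using hpre
    let Ψ : L.Formula M := BoundedFormula.iInf (fun χ : ↥(F ∩ S₂) => pre χ)
    have hΨqf : Ψ.IsQF := isQF_iInf (fun χ => (hpre₁ χ).1)
    have hΨM : Ψ.Realize (id : M → M) := by
      change BoundedFormula.Realize Ψ id default
      rw [BoundedFormula.realize_iInf]
      intro χ
      exact (hpre₁ χ).2
    obtain ⟨w, hw⟩ := hN.exists_realize_of_isQF hΨqf hΨM
    change BoundedFormula.Realize Ψ w default at hw
    rw [BoundedFormula.realize_iInf] at hw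
    refine ⟨Sum.elim w id, fun φ hφ => ?_⟩
    rcases hF hφ with ⟨φ', hφ', rfl⟩ | hφ₂
    · rw [Formula.realize_relabel, Sum.elim_comp_inr]
      exact hφ'
    · have e : (pre ⟨φ, hφ, hφ₂⟩).relabel Sum.inl = φ := hpre₂ ⟨φ, hφ, hφ₂⟩
      rw [← e, Formula.realize_relabel, Sum.elim_comp_inl]
      exact hw ⟨φ, hφ, hφ₂⟩
  -- compactness
  have hsat : ((L.lhomWithConstants (M ⊕ N)).onTheory (∅ : L.Theory) ∪
      Formula.equivSentence '' (S₁ ∪ S₂)).IsSatisfiable := by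
    rw [Theory.isSatisfiable_iff_isFinitelySatisfiable]
    intro T0 hT0
    let F : Set (L.Formula (M ⊕ N)) :=
      {φ | φ ∈ S₁ ∪ S₂ ∧ Formula.equivSentence φ ∈ (T0 : Set L[[M ⊕ N]].Sentence)}
    have hFfin : F.Finite :=
      (T0.finite_toSet.preimage Formula.equivSentence.injective.injOn).subset fun φ hφ => hφ.2
    obtain ⟨v₀, hv₀⟩ := hfin F (fun φ hφ => hφ.1) hFfin
    have h1 := isSatisfiable_union_image_equivSentence_of_realize (∅ : L.Theory) F N v₀ hv₀
    refine h1.mono fun σ hσ => ?_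
    rcases hT0 hσ with hσ₁ | ⟨φ, hφ, rfl⟩
    · exact Or.inl hσ₁
    · exact Or.inr ⟨φ, ⟨hφ, hσ⟩, rfl⟩
  obtain ⟨K, _, _, v, -, hv⟩ :=
    (isSatisfiable_union_image_equivSentence_iff (∅ : L.Theory) (S₁ ∪ S₂)).1 hsat
  -- `v ∘ Sum.inr : N → K` is elementary
  have hg : ∀ {n : ℕ} (φ : L.Formula (Fin n)) (x : Fin n → N),
      φ.Realize ((v ∘ Sum.inr) ∘ x) ↔ φ.Realize x := by
    intro n φ x
    have key : ∀ ψ : L.Formula (Fin n), ψ.Realize x → ψ.Realize ((v ∘ Sum.inr) ∘ x) := by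
      intro ψ hψ
      have hmem : (ψ.relabel x).relabel Sum.inr ∈ S₁ ∪ S₂ := by
        refine Or.inl ⟨ψ.relabel x, ?_, rfl⟩
        change (ψ.relabel x).Realize id
        rw [Formula.realize_relabel]
        exact hψ
      have := hv _ hmem
      rw [Formula.realize_relabel, Formula.realize_relabel] at this
      exact this
    refine ⟨fun hx => ?_, key φ⟩
    by_contra hφ
    exact (Formula.realize_not.1 (key φ.not (Formula.realize_not.2 hφ))) hx
  -- `v ∘ Sum.inl : M → K` is an embedding
  have hqf : ∀ ψ : L.Formula M, ψ.IsQF → ψ.Realize (id : M → M) → ψ.Realize (v ∘ Sum.inl) := by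
    intro ψ h1 h2
    have := hv _ (Or.inr ⟨ψ, ⟨h1, h2⟩, rfl⟩)
    rw [Formula.realize_relabel] at this
    exact this
  exact ⟨K, inferInstance, ⟨v ∘ Sum.inr, @fun n φ x => hg φ x⟩,
    ⟨embeddingOfRealizeQF (v ∘ Sum.inl) hqf⟩⟩

end Amalgamation

/-! ### `T₀ ∪ Th_∃(M) ⊨ Th(M)`, semantically -/

section Criterion

variable {T₀ : L.Theory} {M : Type w} [L.Structure M] [Nonempty M]

omit [Nonempty M] in
/-- Existential sentences pass from `M` to any structure into which `M` embeds; so a model of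
`T₀` into which `M` embeds is a model of `T₀ ∪ Th_∃(M)`. [folklore] -/
theorem model_union_existentialTheory_of_embedding {N : Type w'} [L.Structure N] [N ⊨ T₀]
    (f : M ↪[L] N) : N ⊨ T₀ ∪ L.existentialTheory M := by
  refine Theory.model_union_iff.2 ⟨‹_›, ⟨fun ψ hψ => ?_⟩⟩
  have h1 := hψ.1.realize_embedding f (v := (default : Empty → M)) (xs := (default : Fin 0 → M))
    hψ.2
  have e1 : (f ∘ (default : Empty → M)) = (default : Empty → N) := Subsingleton.elim _ _
  have e2 : (f ∘ (default : Fin 0 → M)) = (default : Fin 0 → N) := Subsingleton.elim _ _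
  rw [e1, e2] at h1
  exact h1

/-- **The easy half of the criterion.** If `T₀ ∪ Th_∃(M) ⊨ φ` for every `φ` true in `M`, then
every model of `T₀` into which `M` embeds (in any universe) satisfies every sentence true in
`M`, i.e. is elementarily equivalent to `M`. [folklore] -/
theorem realize_of_embedding_of_models_union_existentialTheory
    (h : ∀ φ : L.Sentence, M ⊨ φ → (T₀ ∪ L.existentialTheory M) ⊨ᵇ φ)
    (N : Type w') [L.Structure N] [N ⊨ T₀] (f : M ↪[L] N) {φ : L.Sentence} (hφ : M ⊨ φ) :
    N ⊨ φ := by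
  haveI : Nonempty N := (‹Nonempty M›).map f
  haveI : N ⊨ T₀ ∪ L.existentialTheory M := model_union_existentialTheory_of_embedding f
  exact (h φ hφ).realize_sentence N

/-- **The substantial half of the criterion.** If every model `N` of `T₀` (in the universe
`max u v w` of the amalgams) into which `M` embeds satisfies every sentence true in `M`, then
`T₀ ∪ Th_∃(M) ⊨ Th(M)`: a model `N` of `T₀ ∪ Th_∃(M)` has, by existential amalgamation
(`Model.exists_elementaryEmbedding_embedding`), an elementary extension `K` into which `M`
embeds; `K ⊨ T₀`, so `K ≡ M`, and `N ≡ K`. [cite: TentZiegler2012, Lemma 3.1.2] -/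
theorem models_union_existentialTheory_of_forall_embedding
    (h : ∀ (N : Type (max u v w)) [L.Structure N] [N ⊨ T₀], (M ↪[L] N) →
      ∀ φ : L.Sentence, M ⊨ φ → N ⊨ φ)
    {φ : L.Sentence} (hφ : M ⊨ φ) : (T₀ ∪ L.existentialTheory M) ⊨ᵇ φ := by
  refine models_sentence_iff.2 fun N => ?_
  have hT₀ : (N : Type _) ⊨ T₀ := N.is_model.mono subset_union_left
  have hE : (N : Type _) ⊨ L.existentialTheory M := N.is_model.mono subset_union_right
  obtain ⟨K, _, g, ⟨f⟩⟩ := hE.exists_elementaryEmbedding_embedding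
  haveI : K ⊨ T₀ := (g.theory_model_iff T₀).1 hT₀
  exact (g.map_sentence φ).2 (h K f φ hφ)

/-- **`T₀ ∪ Th_∃(M) ⊨ Th(M)` iff every `T₀`-model containing `M` is elementarily equivalent to
`M`.** For a theory `T₀` and a structure `M`, the following are equivalent: (i) every sentence
true in `M` follows from `T₀` together with the existential theory of `M`; (ii) every model of
`T₀` into which `M` embeds satisfies every sentence true in `M`.  ((i) ⇒ (ii): existential
sentences go up along embeddings; (ii) ⇒ (i): existential amalgamation, Tent–Ziegler 2012,
Lemma 3.1.2.)  This is the model-theoretic content of the shape of Macintyre–Wilkie's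
unconditional half. [cite: TentZiegler2012, Lemma 3.1.2] -/
theorem models_union_existentialTheory_iff_forall_embedding :
    (∀ φ : L.Sentence, M ⊨ φ → (T₀ ∪ L.existentialTheory M) ⊨ᵇ φ) ↔
      ∀ (N : Type (max u v w)) [L.Structure N] [N ⊨ T₀], (M ↪[L] N) →
        ∀ φ : L.Sentence, M ⊨ φ → N ⊨ φ :=
  ⟨fun h N _ _ f _ hφ => realize_of_embedding_of_models_union_existentialTheory h N f hφ,
    fun h _ hφ => models_union_existentialTheory_of_forall_embedding h hφ⟩

end Criterion

end Theory

end FirstOrder.Language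

/-! ### The real exponential field -/

noncomputable section

namespace Literature.ModelTheory.ExponentialFields

/-- **The criterion for `ℝ_exp`.** For a set `T₀` of sentences of `Language.orderedExpRing`:
`T₀ ∪ Th_∃(ℝ_exp) ⊨ Th(ℝ_exp)` iff every model of `T₀` into which `ℝ_exp` embeds is a model of
`Th(ℝ_exp) = realExpTheory` (i.e. is elementarily equivalent to `ℝ_exp`). [folklore] -/
theorem realExpTheory_models_union_existential_iff_forall_embedding
    {T₀ : Language.orderedExpRing.Theory} :
    (∀ φ ∈ realExpTheory, (T₀ ∪ realExpExistentialTheory) ⊨ᵇ φ) ↔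
      ∀ (N : Type) [Language.orderedExpRing.Structure N] [N ⊨ T₀],
        (ℝ ↪[Language.orderedExpRing] N) → N ⊨ realExpTheory := by
  have key := Language.Theory.models_union_existentialTheory_iff_forall_embedding
    (L := Language.orderedExpRing) (T₀ := T₀) (M := ℝ)
  constructor
  · intro h N _ _ f
    exact ⟨fun φ hφ => key.1 (fun φ hφ => h φ hφ) N f φ hφ⟩
  · intro h φ hφ
    exact key.2 (fun N _ _ f ψ hψ => (h N f).realize_of_mem ψ hψ) φ hφ

/-- **Macintyre–Wilkie's unconditional half (A0) in model-theoretic form.** The named fact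
`macintyreWilkie_recursiveSubtheory` — a recursive `T₀ ⊆ Th(ℝ_exp)` with
`T₀ ∪ Th_∃(ℝ_exp) ⊨ Th(ℝ_exp)`, i.e. Macintyre–Wilkie's effective model completeness of `ℝ_exp`
(Macintyre–Wilkie 1996, p. 448; Jones–Servi 2011, Prop. 3.1) — is equivalent to: **there is a
recursive set `T₀` of sentences true in `ℝ_exp` such that every model of `T₀` into which `ℝ_exp`
embeds is a model of `Th(ℝ_exp)`** (`Th(ℝ_exp)` is recursively axiomatized over the structures
containing `ℝ_exp`).  A recursive model complete `T₀ ⊆ Th(ℝ_exp)`, which is what Macintyre–Wilkie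
construct, satisfies the right-hand side since then `ℝ_exp ≼ N`.  The fact itself is not proved
here. [cite: MacintyreWilkieKreiseliana1996, p. 448] -/
theorem macintyreWilkie_recursiveSubtheory_iff_forall_embedding :
    macintyreWilkie_recursiveSubtheory ↔
      ∃ T₀ : Language.orderedExpRing.Theory, T₀ ⊆ realExpTheory ∧ T₀.IsRecursive ∧
        ∀ (N : Type) [Language.orderedExpRing.Structure N] [N ⊨ T₀],
          (ℝ ↪[Language.orderedExpRing] N) → N ⊨ realExpTheory := by
  unfold macintyreWilkie_recursiveSubtheory
  exact exists_congr fun _ => and_congr_right fun _ => and_congr_right fun _ =>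
    realExpTheory_models_union_existential_iff_forall_embedding

/-- The sufficient condition extracted from the criterion: a recursive set `T₀` of sentences true
in `ℝ_exp` all of whose models containing `ℝ_exp` are models of `Th(ℝ_exp)` witnesses
`macintyreWilkie_recursiveSubtheory`. [folklore] -/
theorem macintyreWilkie_recursiveSubtheory_of_forall_embedding
    {T₀ : Language.orderedExpRing.Theory} (hT₀ : T₀ ⊆ realExpTheory) (hrec : T₀.IsRecursive)
    (h : ∀ (N : Type) [Language.orderedExpRing.Structure N] [N ⊨ T₀],
      (ℝ ↪[Language.orderedExpRing] N) → N ⊨ realExpTheory) :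
    macintyreWilkie_recursiveSubtheory :=
  macintyreWilkie_recursiveSubtheory_iff_forall_embedding.2 ⟨T₀, hT₀, hrec, h⟩

/-- **A model complete true `T₀` satisfies the criterion** (the way Macintyre–Wilkie's witness
does): if `T₀ ⊆ Th(ℝ_exp)` is model complete, then every model `N` of `T₀` into which `ℝ_exp`
embeds is a model of `Th(ℝ_exp)` — `ℝ_exp ⊨ T₀`, so the embedding is elementary
(Marker 2002, Def. 3.1.10).  With `macintyreWilkie_recursiveSubtheory_of_forall_embedding` this
is the semantic route to `macintyreWilkie_recursiveSubtheory_of_isModelComplete`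
(`MacintyreWilkie.lean`, there via Robinson's test). [cite: Marker2002, Def. 3.1.10 and Prop. 3.1.11] -/
theorem model_realExpTheory_of_isModelComplete {T₀ : Language.orderedExpRing.Theory}
    (hT₀ : T₀ ⊆ realExpTheory) (hmc : T₀.IsModelComplete) (N : Type)
    [Language.orderedExpRing.Structure N] [N ⊨ T₀] (f : ℝ ↪[Language.orderedExpRing] N) :
    N ⊨ realExpTheory := by
  haveI : Nonempty N := ⟨f 0⟩
  haveI : ℝ ⊨ T₀ := Language.Theory.Model.mono (inferInstance : ℝ ⊨ realExpTheory) hT₀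
  let g : ℝ ↪ₑ[Language.orderedExpRing] N :=
    ⟨f, @fun n φ x =>
      hmc (Language.Theory.ModelType.of T₀ ℝ) (Language.Theory.ModelType.of T₀ N) f n φ x⟩
  exact (g.theory_model_iff realExpTheory).1 inferInstance


/-- For a subtheory `T₀ ⊆ Th(ℝ_exp)` with `T₀ ∪ Th_∃(ℝ_exp) ⊨ Th(ℝ_exp)` (a witness of
`macintyreWilkie_recursiveSubtheory`, recursiveness aside), the models of `T₀ ∪ Th_∃(ℝ_exp)` — in
any universe — are exactly the models of `Th(ℝ_exp)`: `T₀ ∪ Th_∃(ℝ_exp)` *axiomatizes* the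
complete theory. [folklore] -/
theorem model_union_realExpExistentialTheory_iff {T₀ : Language.orderedExpRing.Theory}
    (hT₀ : T₀ ⊆ realExpTheory) (hgen : ∀ φ ∈ realExpTheory, (T₀ ∪ realExpExistentialTheory) ⊨ᵇ φ)
    (N : Type*) [Language.orderedExpRing.Structure N] [Nonempty N] :
    N ⊨ T₀ ∪ realExpExistentialTheory ↔ N ⊨ realExpTheory := by
  constructor
  · intro hN
    exact ⟨fun φ hφ => (hgen φ hφ).realize_sentence N⟩
  · intro hN
    exact hN.mono (Set.union_subset hT₀ realExpExistentialTheory_subset_realExpTheory)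

end Literature.ModelTheory.ExponentialFields

end
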